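import Summits.SmoothPoincare4.SmoothPoincare4.Theorems.EntropyRungConicalGapRicciMomentIdentity
import Literature.Geometry.Riemannian.ChangGurskyYangProofs
import Literature.Geometry.Riemannian.EigenvaluePinchingSphereProofs
import HarnessLib

/-!
# Helper `helper_ricciNormSq_traceless` of line `Sketch`
(crux `EntropyRung.ConicalGap`, stmt-SmoothPoincare4-16589)

The **orthogonal decomposition of the Ricci tensor into its trace-free part and its trace**,
pointwise and in `e^{-f/τ}`-weighted integrated form, `n = 4`: on a complete connected normalised
gradient shrinking Ricci soliton `(M⁴, g, f)` (`Ric + Hess f = g/2`, `R + |∇f|² = f`, closed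
`g`-balls compact), with `E = Ric − (R/4) g` the trace-free Ricci tensor (`g.tracelessRicci`),

* pointwise, `|Ric|² = |E|² + R²/4` at every point (any dimension `m`: `|Ric|² = |E|² + R²/m`,
  `normSq_ricci_eq_normSq_tracelessRicci_add`), from
  `|T + c g|² = |T|² + 2 c tr_g T + c² m` (`normSq_add_smul_toBilinForm`) with `T = Ric`
  (symmetric, `ricci_symm_holds`), `c = −R/m`, `tr_g Ric = R`;
* for every `τ > 0`, GIVEN that `|Ric|² e^{-f/σ}` is integrable for all `σ > 0` (hypothesis),
  `|E|² e^{-f/τ}` is integrable and `∫ |Ric|² e^{-f/τ} = ∫ |E|² e^{-f/τ} + ¼ ∫ R² e^{-f/τ}`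
  (`R² e^{-f/τ}` is integrable by `ricciMoment_integrable_sq`, from `0 ≤ R ≤ f`, properness of `f`
  and `R ≥ 0`, `NoncompactShrinkerGapCarrilloNiClauses.scalarCurvature_nonneg_and_isCompact_sublevel`).

Everything here is proved; no definition and no named fact is introduced.

## References

* S.-Y. A. Chang, M. J. Gursky, P. C. Yang, *A conformally invariant sphere theorem in four
  dimensions*, Publ. Math. IHÉS 98 (2003) 105–143, (0.1)–(0.2). [ChangGurskyYang2003]
* B. O'Neill, *Semi-Riemannian geometry*, Academic Press 1983, Ch. 3, pp. 60–61. [ONeill1983]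
* O. Munteanu, J. Wang, *Structure at infinity for shrinking Ricci solitons*, arXiv:1606.01861,
  §2. [MunteanuWang2016]
-/

noncomputable section

-- `Summit.SmoothPoincare4.SmoothPoincare4.…` (summit = problem) trips `dupNamespace` on every decl.
set_option linter.dupNamespace false

open scoped Manifold ContDiff ENNReal NNReal Topology
open MeasureTheory Set Filter
open Literature.Geometry.Lorentzian Literature.Geometry.Riemannian

namespace Summit.SmoothPoincare4.SmoothPoincare4.Theorems.ConicalGapSketch

/-! ## The pointwise decomposition `|Ric|² = |E|² + R²/m` (any dimension) -/

section Pointwise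

variable {n : ℕ} {M : Type*} [TopologicalSpace M] [ChartedSpace (EuclideanSpace ℝ (Fin n)) M]
  [IsManifold (𝓡 n) ∞ M]
  {g : PseudoRiemannianMetric (𝓡 n) ∞ (EuclideanSpace ℝ (Fin n)) (TangentSpace (𝓡 n) : M → Type _)}
  [g.HasLeviCivita]

/-- **`|Ric|² = |E|² + R²/m` pointwise** (`m = n` the dimension, `E = Ric − (R/m) g` the trace-free
Ricci tensor): `E = Ric + c g` with `c = −R/m`, so `|E|² = |Ric|² + 2 c tr_g Ric + c² m`
(`normSq_add_smul_toBilinForm`, `Ric` symmetric by `ricci_symm_holds`) `= |Ric|² − R²/m`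
(`tr_g Ric = R` by definition of the scalar curvature). For `m = 0` both correction terms vanish. -/
theorem normSq_ricci_eq_normSq_tracelessRicci_add (x : M) :
    g.normSq x (g.ricci x) = g.normSq x (g.tracelessRicci x) + g.scalarCurvature x ^ 2 / n := by
  have hsymm : ∀ v w, g.ricci x v w = g.ricci x w v := fun v w ↦
    (PseudoRiemannianMetric.ricci_symm_holds (g := g) (WithTop.coe_le_coe.mpr le_top) x).eq v w
  have hE : g.tracelessRicci x =
      g.ricci x + (-(g.scalarCurvature x / n)) • g.toBilinForm x := by
    ext v w
    simp only [PseudoRiemannianMetric.tracelessRicci_apply, LinearMap.add_apply,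
      LinearMap.smul_apply, PseudoRiemannianMetric.toBilinForm_apply, smul_eq_mul,
      finrank_euclideanSpace_fin]
    ring
  have htr : g.trace x (g.ricci x) = g.scalarCurvature x := rfl
  rw [hE, PseudoRiemannianMetric.normSq_add_smul_toBilinForm g x hsymm, finrank_euclideanSpace_fin,
    htr]
  rcases eq_or_ne (n : ℝ) 0 with h | h
  · simp [h]
  · field_simp
    ring

/-- **`|E|² = |Ric|² − R²/m` pointwise**, the rearranged form of
`normSq_ricci_eq_normSq_tracelessRicci_add`. -/
theorem normSq_tracelessRicci_eq (x : M) :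
    g.normSq x (g.tracelessRicci x) = g.normSq x (g.ricci x) - g.scalarCurvature x ^ 2 / n := by
  rw [normSq_ricci_eq_normSq_tracelessRicci_add x]
  ring

end Pointwise

/-! ## The weighted integral decomposition (any dimension, over `g.riemVolume`) -/

section Weighted

variable {n : ℕ} {M : Type*} [TopologicalSpace M] [ChartedSpace (EuclideanSpace ℝ (Fin n)) M]
  [IsManifold (𝓡 n) ∞ M] [T3Space M] [MeasurableSpace M] [BorelSpace M]
  {g : PseudoRiemannianMetric (𝓡 n) ∞ (EuclideanSpace ℝ (Fin n)) (TangentSpace (𝓡 n) : M → Type _)}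
  {f : M → ℝ} [g.HasLeviCivita]

/-- **`|E|² e^{-f/τ}` is integrable and `∫ |Ric|² e^{-f/τ} = ∫ |E|² e^{-f/τ} + (1/m) ∫ R² e^{-f/τ}`**
over `g.riemVolume`, on a gradient shrinker with proper potential and `R ≥ 0`, GIVEN integrability
of `|Ric|² e^{-f/τ}`: pointwise `|E|² e^{-f/τ} = |Ric|² e^{-f/τ} − (R²/m) e^{-f/τ}`
(`normSq_tracelessRicci_eq`) with both terms integrable (`ricciMoment_integrable_sq` for the
second), then `integral_sub`. -/
theorem integrable_normSq_tracelessRicci_and_integral_eq (hg : g.IsRiemannian)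
    (hf : ContMDiff (𝓡 n) 𝓘(ℝ, ℝ) ∞ f)
    (hsol : ∀ (x : M) (X Y : TangentSpace (𝓡 n) x),
      g.ricci x X Y + g.hessian f x X Y = (1 / 2 : ℝ) * g.val x X Y)
    (hnorm : ∀ x : M, g.scalarCurvature x + g.gradSq f x = f x)
    (hprop : ∀ R : ℝ, IsCompact {x | f x ≤ R}) (hR0 : ∀ x, 0 ≤ g.scalarCurvature x) {τ : ℝ}
    (hτ : 0 < τ)
    (hRic : Integrable (fun x ↦ g.normSq x (g.ricci x) * Real.exp (-f x / τ)) g.riemVolume) :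
    Integrable (fun x ↦ g.normSq x (g.tracelessRicci x) * Real.exp (-f x / τ)) g.riemVolume ∧
      ∫ x, g.normSq x (g.ricci x) * Real.exp (-f x / τ) ∂g.riemVolume =
        (∫ x, g.normSq x (g.tracelessRicci x) * Real.exp (-f x / τ) ∂g.riemVolume) +
          1 / n * ∫ x, g.scalarCurvature x ^ 2 * Real.exp (-f x / τ) ∂g.riemVolume := by
  have iR2 := ricciMoment_integrable_sq hg hf hsol hnorm hprop hR0 hτ
  -- pointwise `|E|² v = |Ric|² v − (1/m) (R² v)`
  have hpt : ∀ x, g.normSq x (g.tracelessRicci x) * Real.exp (-f x / τ) =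
      g.normSq x (g.ricci x) * Real.exp (-f x / τ) -
        1 / n * (g.scalarCurvature x ^ 2 * Real.exp (-f x / τ)) := fun x ↦ by
    rw [normSq_tracelessRicci_eq x]
    ring
  have iE : Integrable (fun x ↦ g.normSq x (g.tracelessRicci x) * Real.exp (-f x / τ))
      g.riemVolume :=
    (hRic.sub (iR2.const_mul _)).congr (Eventually.of_forall fun x ↦ (hpt x).symm)
  refine ⟨iE, ?_⟩
  have hI : ∫ x, g.normSq x (g.tracelessRicci x) * Real.exp (-f x / τ) ∂g.riemVolume =
      (∫ x, g.normSq x (g.ricci x) * Real.exp (-f x / τ) ∂g.riemVolume) -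
        1 / n * ∫ x, g.scalarCurvature x ^ 2 * Real.exp (-f x / τ) ∂g.riemVolume := by
    simp_rw [hpt]
    rw [integral_sub hRic (iR2.const_mul _), integral_const_mul]
  rw [hI]
  ring

end Weighted

/-! ## The registered helper (n = 4) -/

/-- **Helper `helper_ricciNormSq_traceless` of line `Sketch`** (`|Ric|² = |E|² + R²/4` and its
`e^{-f/τ}`-weighted integral, `n = 4`): on every complete connected normalised 4-d gradient
shrinking Ricci soliton, (i) `|Ric|²(x) = |E|²(x) + R(x)²/4` at every point `x`
(`E = Ric − (R/4) g = g.tracelessRicci`; `normSq_ricci_eq_normSq_tracelessRicci_add` with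
`finrank ℝ (EuclideanSpace ℝ (Fin 4)) = 4`), and (ii) GIVEN that `|Ric|² e^{-f/σ}` is integrable
for every `σ > 0`, for every `τ > 0` the weight `|E|² e^{-f/τ}` is integrable and
`∫ |Ric|² e^{-f/τ} dV = ∫ |E|² e^{-f/τ} dV + ¼ ∫ R² e^{-f/τ} dV`
(`integrable_normSq_tracelessRicci_and_integral_eq`; `dV` the Riemannian measure of
`g.toContMDiffRiemannianMetric hg`, to which `g.riemVolume` unfolds by `riemVolume_eq`; properness
of `f` and `R ≥ 0` by
`NoncompactShrinkerGapCarrilloNiClauses.scalarCurvature_nonneg_and_isCompact_sublevel`). -/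
theorem helper_ricciNormSq_traceless : ∀ (M : Type) [TopologicalSpace M] [T2Space M] [SecondCountableTopology M] [ChartedSpace (EuclideanSpace ℝ (Fin 4)) M] [IsManifold (𝓡 4) ∞ M] [ConnectedSpace M] [T3Space M] [MeasurableSpace M] [BorelSpace M] (g : Literature.Geometry.Lorentzian.PseudoRiemannianMetric (𝓡 4) ∞ (EuclideanSpace ℝ (Fin 4)) (TangentSpace (𝓡 4) : M → Type _)) [g.HasLeviCivita] (f : M → ℝ) (hg : g.IsRiemannian), (∀ (x : M) (r : NNReal), IsCompact {y : M | g.edist hg x y ≤ r}) → ContMDiff (𝓡 4) 𝓘(ℝ, ℝ) ∞ f → (∀ (x : M) (X Y : TangentSpace (𝓡 4) x), g.ricci x X Y + g.hessian f x X Y = (1 / 2 : ℝ) * g.val x X Y) → (∀ x : M, g.scalarCurvature x + g.gradSq f x = f x) → (∀ x : M, g.normSq x (g.ricci x) = g.normSq x (g.tracelessRicci x) + g.scalarCurvature x ^ 2 / 4) ∧ ((∀ σ : ℝ, 0 < σ → MeasureTheory.Integrable (fun x ↦ g.normSq x (g.ricci x) * Real.exp (-f x / σ)) (Literature.Geometry.Lorentzian.riemannianMeasure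 (g.toContMDiffRiemannianMetric hg))) → ∀ τ : ℝ, 0 < τ → MeasureTheory.Integrable (fun x ↦ g.normSq x (g.tracelessRicci x) * Real.exp (-f x / τ)) (Literature.Geometry.Lorentzian.riemannianMeasure (g.toContMDiffRiemannianMetric hg)) ∧ ∫ x, g.normSq x (g.ricci x) * Real.exp (-f x / τ) ∂(Literature.Geometry.Lorentzian.riemannianMeasure (g.toContMDiffRiemannianMetric hg)) = (∫ x, g.normSq x (g.tracelessRicci x) * Real.exp (-f x / τ) ∂(Literature.Geometry.Lorentzian.riemannianMeasure (g.toContMDiffRiemannianMetric hg))) + 1 / 4 * ∫ x, g.scalarCurvature x ^ 2 * Real.exp (-f x / τ) ∂(Literature.Geometry.Lorentzian.riemannianMeasure (g.toContMDiffRiemannianMetric hg))) := by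
  intro M _ _ _ _ _ _ _ _ _ g _ f hg hc hf hsol hnorm
  refine ⟨fun x ↦ ?_, fun hRic τ hτ ↦ ?_⟩
  · have h := normSq_ricci_eq_normSq_tracelessRicci_add (g := g) x
    simpa only [Nat.cast_ofNat] using h
  · obtain ⟨hR0, -, hprop⟩ :=
      NoncompactShrinkerGapCarrilloNiClauses.scalarCurvature_nonneg_and_isCompact_sublevel g f hg hc
        hf hsol hnorm
    rw [← PseudoRiemannianMetric.riemVolume_eq hg] at hRic ⊢
    have h := integrable_normSq_tracelessRicci_and_integral_eq hg hf hsol hnorm hprop hR0 hτ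
      (hRic τ hτ)
    simpa only [Nat.cast_ofNat] using h

end Summit.SmoothPoincare4.SmoothPoincare4.Theorems.ConicalGapSketch

end
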